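import Literature.Analysis.OperatorTheory.Enflo2023.CaseIIBranch
import HarnessLib

/-!
# Enflo (2023), Part A p.12: Case I — the tail of THE minimal solution is bounded below ((25), repaired)

Source under adjudication: Per H. Enflo, *On the invariant subspace problem in Hilbert spaces*, arXiv:2305.15442
(v2, 2024), bib key `Enflo2023`.  [cite: Enflo2023, v2 p.12, "Before continuing after `ℓ_n(T)y_n = y₁'` … we
shall arrange to have an estimate from below of `Σ_{j≥1}|a_j|²`", Case I and eq. (25) (tex L386–L399): "Case I.
`|⟨T^j y₁', x₀ − y₁'⟩| ≥ (εθ)⁴` for some `j`. Then `‖x₀ − [(1 − (εθ)'')y₁' + (εθ)⁶T^j y₁']‖ ≤ ‖x₀ − y₁'‖ + (εθ)''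
− (εθ)^{10} + (εθ)^{12} < ‖x₀ − y₁'‖` and with `(1 − (εθ)'')² + ((εθ)⁶)² < 1` we see that, for `inf Σ_{j≥0}|a_j|²`
in `‖Σ_{j≥0} a_j T^j y₁' − x₀‖ ≤ ‖x₀ − y₁'‖` we have (25) `Σ_{j≥1}|a_j|² ≥ (εθ)^{15}`."]

This module is os-F3b / BLOCK-2b repair-cell work (`pub-enflo`): kernel-checked statements ABOUT one step of the
manuscript (formaliser 1, Part A).  NOTHING here asserts the manuscript's main theorem; no declaration concludes
the invariant subspace problem for an arbitrary operator.

WHAT IS PROVED (the text's own constants `‖T‖ = 10⁻²⁰`; `(εθ)''` read as `(εθ)^{10}`, the only reading under which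
the printed competitor is feasible).  Let `⟨x₀ − y, y⟩ = εθ ∈ (0, 10⁻³]` (real), `‖y‖ ≤ 1`, `‖x₀ − y‖ < ‖x₀‖`, and let
`c` be THE minimal solution of (1) for `V_y` at radius `‖x₀ − y‖` (the infimum in (25); the object of Lemma 2).
* `CaseI.competitor_feasible`, `CaseI.norm_sq_le_of_caseI` — Case I at an index `j ≥ 1` makes the text's competitor
  `b = (1 − (εθ)^{10})e₀ + (εθ)⁶e^{iφ}e_j` feasible, so `‖c‖² ≤ ‖b‖² = (1 − (εθ)^{10})² + (εθ)^{12} ≤ 1 − 1.99(εθ)^{10}`;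
  hence `Re c₀ ≤ |c₀| ≤ 1 − 0.99(εθ)^{10}` (`CaseI.re_head_le_of_caseI`).  This is the printed display, checked.
* `CaseI.activity_identity` — for THE minimiser (no Case I needed), with `d = 1 − c₀`, `w₁ = Σ_{j≥1} c_j T^j y`:
  `2εθ·Re d + ‖d·y − w₁‖² = 2Re⟨x₀ − y, w₁⟩` (the constraint is active).  So the progress `2εθ·Re d ≥ 1.98(εθ)^{11}`
  lost by shrinking the head must be repaid by the pairing of `x₀ − y` with the TAIL — this is the inference from
  the display to (25) that the text leaves to the reader.
* `CaseI.tail_lower_bound_of_caseI` — **(25), repaired, log-free**: `‖Lc‖ = (Σ_{j≥1}|c_j|²)^{1/2} ≥ 0.98·10²⁰·(εθ)^{11}`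
  (pairing bounded by `‖x₀ − y‖·‖w₁‖ ≤ 1.0001·10⁻²⁰‖Lc‖`); `CaseI.tail_lower_bound_of_caseI_h9` — with (9) at `y`
  (`|⟨x₀ − y, T^j y⟩| ≤ εθ`, all `j`): `(m + 2)·‖Lc‖ ≥ 0.99(εθ)^{10}`, `m = [1 + log_K(1/εθ)]` (pairing bounded by
  `Lemma2.norm_inner_V_le`) — the referee's corrected exponent "`(εθ)^{20}/(2 log_K(1/εθ))`" (packet STEPS S13/A24).
* `CaseI.eq25_printed_of_caseI` — the PRINTED (25), `Σ_{j≥1}|c_j|² ≥ (εθ)^{15}`, follows for `εθ ≥ 2·10⁻⁶`; for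
  smaller `εθ` (the run of (26) drives `εθ → 0`) the derivable exponent is `22` (log-free) resp. `20` up to the
  logarithm, not `15`: a SLIP of the harmless-constant class — downstream ((33), v2 p.15) only an explicit positive
  lower bound `f(εθ)` for the tail is consumed.

Origin: planner-b2b-enflo-1-g8-0 (F1 gen-8), 2026-08-19.
-/

noncomputable section

open scoped InnerProductSpace ENNReal
open Literature.Analysis.UnboundedOperators (inner_self_eq_coe_norm_sq)

namespace Literature.Analysis.OperatorTheory.Enflo2023

variable {H : Type*} [NormedAddCommGroup H] [InnerProductSpace ℂ H] [CompleteSpace H]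

namespace CaseI

open Vy Lemma2 CaseII

/-! ### The text's competitor `(1 − (εθ)^{10})e₀ + (εθ)⁶e^{iφ}e_j` -/

/-- `‖α e₀ + β e_j‖² = |α|² + |β|²` in `ℓ²` for `j ≠ 0` (the text's "`(1 − (εθ)'')² + ((εθ)⁶)² < 1`"). [cite: Enflo2023, v2 p.12, Case I (tex L392–L394)] -/
lemma norm_sq_two_singles {j : ℕ} (hj : j ≠ 0) (α β : ℂ) :
    ‖(α • (lp.single 2 0 (1 : ℂ) : ℓ2) + β • (lp.single 2 j (1 : ℂ) : ℓ2))‖ ^ 2 = ‖α‖ ^ 2 + ‖β‖ ^ 2 := by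
  rw [norm_sq_eq_tsum]
  have happ : ∀ i, (α • (lp.single 2 0 (1 : ℂ) : ℓ2) + β • (lp.single 2 j (1 : ℂ) : ℓ2)) i
      = α * (Pi.single (M := fun _ : ℕ => ℂ) 0 1 i) + β * (Pi.single (M := fun _ : ℕ => ℂ) j 1 i) := by
    intro i
    rw [lp.coeFn_add, Pi.add_apply, lp.coeFn_smul, lp.coeFn_smul, Pi.smul_apply, Pi.smul_apply,
      lp.single_apply, lp.single_apply, smul_eq_mul, smul_eq_mul]
  have hsupp : ∀ i ∉ ({0, j} : Finset ℕ),
      ‖(α • (lp.single 2 0 (1 : ℂ) : ℓ2) + β • (lp.single 2 j (1 : ℂ) : ℓ2)) i‖ ^ 2 = 0 := by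
    intro i hi
    rw [Finset.mem_insert, Finset.mem_singleton, not_or] at hi
    rw [happ, Pi.single_eq_of_ne hi.1, Pi.single_eq_of_ne hi.2]
    simp
  rw [tsum_eq_sum hsupp, Finset.sum_pair (Ne.symm hj), happ, happ, Pi.single_eq_same, Pi.single_eq_same,
    Pi.single_eq_of_ne hj, Pi.single_eq_of_ne (Ne.symm hj)]
  simp

/-- `V_y(α e₀ + β e_j) = α y + β T^j y`. [cite: Enflo2023, v2 p.2, eq. (2)] -/
lemma V_two_singles (T : H →L[ℂ] H) (hT : ‖T‖ < 1) (y : H) (j : ℕ) (α β : ℂ) :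
    V T hT y (α • (lp.single 2 0 (1 : ℂ) : ℓ2) + β • (lp.single 2 j (1 : ℂ) : ℓ2)) = α • y + β • (T ^ j) y := by
  rw [map_add, map_smul, map_smul, V_single, V_single, pow_zero, one_apply_eq_self]

/-- **The printed competitor is feasible.**  `‖T‖ ≤ 10⁻²⁰`, `⟨x₀ − y, y⟩ = εθ ∈ (0, 10⁻³]`, `‖y‖ ≤ 1`, Case I at
`j ≥ 1`: `|⟨x₀ − y, T^j y⟩| ≥ (εθ)⁴`.  With `u = conj z/|z|`, `z = ⟨x₀ − y, T^j y⟩`, the vector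
`b = (1 − (εθ)^{10})e₀ + (εθ)⁶u·e_j` has `‖x₀ − V_y b‖² ≤ ‖x₀ − y‖² − 1.99(εθ)^{10}` (so `b` is feasible at radius
`‖x₀ − y‖`) and `‖b‖² = (1 − (εθ)^{10})² + (εθ)^{12} ≤ 1 − 1.99(εθ)^{10}`. [cite: Enflo2023, v2 p.12, Case I (tex L390–L394)] -/
theorem competitor_feasible (T : H →L[ℂ] H) (hT1 : ‖T‖ < 1) (hT : ‖T‖ ≤ 1 / 10 ^ 20) (x₀ y : H) (t : ℝ)
    (ht : ⟪x₀ - y, y⟫_ℂ = t) (ht0 : 0 < t) (ht1 : t ≤ 1 / 10 ^ 3) (hy1 : ‖y‖ ≤ 1)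
    {j : ℕ} (hj : 1 ≤ j) (hz : t ^ 4 ≤ ‖⟪x₀ - y, (T ^ j) y⟫_ℂ‖) :
    ∃ b : ℓ2, ‖x₀ - V T hT1 y b‖ ^ 2 ≤ ‖x₀ - y‖ ^ 2 - 1.99 * t ^ 10 ∧ ‖x₀ - V T hT1 y b‖ ≤ ‖x₀ - y‖ ∧
      ‖b‖ ^ 2 ≤ 1 - 1.99 * t ^ 10 := by
  set z : ℂ := ⟪x₀ - y, (T ^ j) y⟫_ℂ with hz_def
  have ht4 : 0 < t ^ 4 := pow_pos ht0 4
  have hzpos : 0 < ‖z‖ := lt_of_lt_of_le ht4 hz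
  have hz0 : z ≠ 0 := norm_pos_iff.1 hzpos
  set u : ℂ := (starRingEnd ℂ) z / (‖z‖ : ℂ) with hu_def
  have hzC : (‖z‖ : ℂ) ≠ 0 := by exact_mod_cast hzpos.ne'
  have hu1 : ‖u‖ = 1 := by
    rw [hu_def, norm_div, Complex.norm_conj, Complex.norm_real, Real.norm_of_nonneg hzpos.le, div_self hzpos.ne']
  have huz : u * z = (‖z‖ : ℂ) := by
    rw [hu_def, div_mul_eq_mul_div, ← Complex.normSq_eq_conj_mul_self, Complex.normSq_eq_norm_sq]
    push_cast
    rw [sq, mul_div_assoc, div_self hzC, mul_one]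
  set s : ℝ := t ^ 10 with hs_def
  set τ : ℝ := t ^ 6 with hτ_def
  have hs0 : 0 ≤ s := pow_nonneg ht0.le 10
  have hτ0 : 0 ≤ τ := pow_nonneg ht0.le 6
  refine ⟨((1 - s : ℝ) : ℂ) • (lp.single 2 0 (1 : ℂ) : ℓ2) + ((τ : ℂ) * u) • (lp.single 2 j (1 : ℂ) : ℓ2), ?_⟩
  have hjne : j ≠ 0 := by omega
  -- the coefficient norm
  have hb : ‖((1 - s : ℝ) : ℂ) • (lp.single 2 0 (1 : ℂ) : ℓ2) + ((τ : ℂ) * u) • (lp.single 2 j (1 : ℂ) : ℓ2)‖ ^ 2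
      = (1 - s) ^ 2 + τ ^ 2 := by
    rw [norm_sq_two_singles hjne, Complex.norm_real, Real.norm_eq_abs, sq_abs, norm_mul, hu1, mul_one,
      Complex.norm_real, Real.norm_of_nonneg hτ0]
  -- powers of `t`
  have hp10 : t ^ 10 ≤ 1 / 10 ^ 30 := by
    calc t ^ 10 ≤ (1 / 10 ^ 3) ^ 10 := pow_le_pow_left₀ ht0.le ht1 10
      _ = 1 / 10 ^ 30 := by norm_num
  have hp11 : t ^ 11 ≤ 1 / 10 ^ 3 * t ^ 10 := by
    calc t ^ 11 = t * t ^ 10 := by ring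
      _ ≤ 1 / 10 ^ 3 * t ^ 10 := mul_le_mul_of_nonneg_right ht1 hs0
  have hp12 : t ^ 12 ≤ 1 / 10 ^ 6 * t ^ 10 := by
    have h2 : t ^ 2 ≤ (1 / 10 ^ 3) ^ 2 := pow_le_pow_left₀ ht0.le ht1 2
    calc t ^ 12 = t ^ 2 * t ^ 10 := by ring
      _ ≤ (1 / 10 ^ 3) ^ 2 * t ^ 10 := mul_le_mul_of_nonneg_right h2 hs0
      _ = 1 / 10 ^ 6 * t ^ 10 := by norm_num
  have hp16 : t ^ 16 ≤ 1 * t ^ 10 := by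
    have h6 : t ^ 6 ≤ 1 := pow_le_one₀ ht0.le (by linarith only [ht1])
    calc t ^ 16 = t ^ 6 * t ^ 10 := by ring
      _ ≤ 1 * t ^ 10 := mul_le_mul_of_nonneg_right h6 hs0
  have hp20 : t ^ 20 ≤ 1 / 10 ^ 30 * t ^ 10 := by
    calc t ^ 20 = t ^ 10 * t ^ 10 := by ring
      _ ≤ 1 / 10 ^ 30 * t ^ 10 := mul_le_mul_of_nonneg_right hp10 hs0
  -- the image of the competitor and the distance to `x₀`
  have hVb : V T hT1 y (((1 - s : ℝ) : ℂ) • (lp.single 2 0 (1 : ℂ) : ℓ2)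
      + ((τ : ℂ) * u) • (lp.single 2 j (1 : ℂ) : ℓ2)) = ((1 - s : ℝ) : ℂ) • y + ((τ : ℂ) * u) • (T ^ j) y :=
    V_two_singles T hT1 y j _ _
  have hsplit : x₀ - (((1 - s : ℝ) : ℂ) • y + ((τ : ℂ) * u) • (T ^ j) y)
      = (x₀ - y) + (((s : ℝ) : ℂ) • y - ((τ : ℂ) * u) • (T ^ j) y) := by
    rw [Complex.ofReal_sub, Complex.ofReal_one, sub_smul, one_smul]; abel
  have hTjy : ‖(T ^ j) y‖ ≤ 1 / 10 ^ 20 := by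
    calc ‖(T ^ j) y‖ ≤ ‖T‖ ^ j * ‖y‖ := norm_pow_apply_le T j y
      _ ≤ ‖T‖ ^ 1 * 1 := mul_le_mul (pow_le_pow_of_le_one (norm_nonneg _) hT1.le hj) hy1
          (norm_nonneg _) (pow_nonneg (norm_nonneg _) 1)
      _ ≤ 1 / 10 ^ 20 := by rw [pow_one, mul_one]; exact hT
  have hpert : ‖((s : ℝ) : ℂ) • y - ((τ : ℂ) * u) • (T ^ j) y‖ ≤ s + τ * (1 / 10 ^ 20) := by
    calc ‖((s : ℝ) : ℂ) • y - ((τ : ℂ) * u) • (T ^ j) y‖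
        ≤ ‖((s : ℝ) : ℂ) • y‖ + ‖((τ : ℂ) * u) • (T ^ j) y‖ := norm_sub_le _ _
      _ = s * ‖y‖ + τ * ‖(T ^ j) y‖ := by
          rw [norm_smul, norm_smul, norm_mul, hu1, mul_one, Complex.norm_real, Complex.norm_real,
            Real.norm_of_nonneg hs0, Real.norm_of_nonneg hτ0]
      _ ≤ s * 1 + τ * (1 / 10 ^ 20) := by gcongr
      _ = s + τ * (1 / 10 ^ 20) := by ring
  have hcross : (⟪x₀ - y, ((s : ℝ) : ℂ) • y - ((τ : ℂ) * u) • (T ^ j) y⟫_ℂ).re = s * t - τ * ‖z‖ := by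
    rw [inner_sub_right, inner_smul_right, inner_smul_right, ht, ← hz_def, mul_assoc, huz]
    simp only [Complex.sub_re, Complex.mul_re, Complex.ofReal_re, Complex.ofReal_im, sub_zero,
      mul_zero]
  have hdist : ‖x₀ - V T hT1 y (((1 - s : ℝ) : ℂ) • (lp.single 2 0 (1 : ℂ) : ℓ2)
      + ((τ : ℂ) * u) • (lp.single 2 j (1 : ℂ) : ℓ2))‖ ^ 2 ≤ ‖x₀ - y‖ ^ 2 - 1.99 * t ^ 10 := by
    rw [hVb, hsplit, norm_add_sq (𝕜 := ℂ) (x₀ - y), RCLike.re_to_complex, hcross]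
    have hsq : ‖((s : ℝ) : ℂ) • y - ((τ : ℂ) * u) • (T ^ j) y‖ ^ 2 ≤ (s + τ * (1 / 10 ^ 20)) ^ 2 :=
      pow_le_pow_left₀ (norm_nonneg _) hpert 2
    have hτz : τ * t ^ 4 ≤ τ * ‖z‖ := mul_le_mul_of_nonneg_left hz hτ0
    have hτt : τ * t ^ 4 = t ^ 10 := by rw [hτ_def]; ring
    have hexp : (s + τ * (1 / 10 ^ 20)) ^ 2 = t ^ 20 + 2 / 10 ^ 20 * t ^ 16 + 1 / 10 ^ 40 * t ^ 12 := by
      rw [hs_def, hτ_def]; ring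
    rw [hexp] at hsq
    have hst : s * t = t ^ 11 := by rw [hs_def]; ring
    linarith only [hsq, hτz, hτt, hst, hp11, hp12, hp16, hp20, hs0, hs_def]
  have hρ0 : 0 ≤ ‖x₀ - y‖ := norm_nonneg _
  refine ⟨hdist, ?_, ?_⟩
  · exact (pow_le_pow_iff_left₀ (norm_nonneg _) hρ0 two_ne_zero).1 (by linarith only [hdist, hs0, hs_def])
  · rw [hb]
    have : (1 - s) ^ 2 + τ ^ 2 = 1 - 2 * t ^ 10 + t ^ 20 + t ^ 12 := by rw [hs_def, hτ_def]; ring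
    rw [this]; linarith only [hp12, hp20, hs0, hs_def]

/-- **Case I bounds the coefficient norm of THE minimiser away from `1`.**  Setting of `competitor_feasible`;
`c` THE minimal solution of (1) for `V_y` at radius `‖x₀ − y‖` (the infimum in (25)).  Then
`‖c‖² ≤ 1 − 1.99(εθ)^{10}` (minimality against the feasible competitor). [cite: Enflo2023, v2 p.12, Case I and eq. (25) (tex L390–L399)] -/
theorem norm_sq_le_of_caseI (T : H →L[ℂ] H) (hT1 : ‖T‖ < 1) (hT : ‖T‖ ≤ 1 / 10 ^ 20) (x₀ y : H) (t : ℝ)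
    (ht : ⟪x₀ - y, y⟫_ℂ = t) (ht0 : 0 < t) (ht1 : t ≤ 1 / 10 ^ 3) (hy1 : ‖y‖ ≤ 1)
    (hI : ∃ j, 1 ≤ j ∧ t ^ 4 ≤ ‖⟪x₀ - y, (T ^ j) y⟫_ℂ‖) {c : ℓ2} (hc : IsMinimal (V T hT1 y) x₀ ‖x₀ - y‖ c) :
    ‖c‖ ^ 2 ≤ 1 - 1.99 * t ^ 10 := by
  obtain ⟨j, hj, hz⟩ := hI
  obtain ⟨b, -, hfeas, hb⟩ := competitor_feasible T hT1 hT x₀ y t ht ht0 ht1 hy1 hj hz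
  have hcb : ‖c‖ ≤ ‖b‖ := hc.norm_le (by rw [mem_feasible]; exact hfeas)
  exact le_trans (pow_le_pow_left₀ (norm_nonneg _) hcb 2) hb

/-- Hence the head coefficient of THE minimiser satisfies `Re c₀ ≤ |c₀| ≤ 1 − 0.99(εθ)^{10}`, i.e.
`Re d ≥ 0.99(εθ)^{10}` for `d = 1 − c₀`. [cite: Enflo2023, v2 p.12, Case I and eq. (25)] -/
theorem re_head_le_of_caseI (T : H →L[ℂ] H) (hT1 : ‖T‖ < 1) (hT : ‖T‖ ≤ 1 / 10 ^ 20) (x₀ y : H) (t : ℝ)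
    (ht : ⟪x₀ - y, y⟫_ℂ = t) (ht0 : 0 < t) (ht1 : t ≤ 1 / 10 ^ 3) (hy1 : ‖y‖ ≤ 1)
    (hI : ∃ j, 1 ≤ j ∧ t ^ 4 ≤ ‖⟪x₀ - y, (T ^ j) y⟫_ℂ‖) {c : ℓ2} (hc : IsMinimal (V T hT1 y) x₀ ‖x₀ - y‖ c) :
    ‖c 0‖ ≤ 1 - 0.99 * t ^ 10 ∧ (c 0).re ≤ 1 - 0.99 * t ^ 10 := by
  have h := norm_sq_le_of_caseI T hT1 hT x₀ y t ht ht0 ht1 hy1 hI hc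
  have hc0 : ‖c 0‖ ^ 2 ≤ ‖c‖ ^ 2 := pow_le_pow_left₀ (norm_nonneg _) (lp.norm_apply_le_norm (by norm_num) c 0) 2
  have hs0 : 0 ≤ t ^ 10 := pow_nonneg ht0.le 10
  have hp10 : t ^ 10 ≤ 1 / 10 ^ 30 := by
    calc t ^ 10 ≤ (1 / 10 ^ 3) ^ 10 := pow_le_pow_left₀ ht0.le ht1 10
      _ = 1 / 10 ^ 30 := by norm_num
  have hn : ‖c 0‖ ≤ 1 - 0.99 * t ^ 10 := by
    by_contra hcon
    push Not at hcon
    have h1 : 0 ≤ 1 - 0.99 * t ^ 10 := by linarith only [hp10, hs0]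
    have h2 : (1 - 0.99 * t ^ 10) ^ 2 < ‖c 0‖ ^ 2 := by
      have := mul_self_lt_mul_self h1 hcon
      rw [← sq, ← sq] at this; exact this
    nlinarith [h, hc0, h2, hs0, hp10]
  exact ⟨hn, le_trans (le_trans (le_abs_self _) (Complex.abs_re_le_norm _)) hn⟩

/-! ### The active constraint: the lost progress is repaid by the tail -/

/-- **Activity identity for THE minimiser at radius `‖x₀ − y‖`** (no Case I needed): if `⟨x₀ − y, y⟩ = εθ` (real)
and `‖x₀ − y‖ < ‖x₀‖`, then with `d = 1 − c₀` and `w₁ = V_y(S(Lc)) = Σ_{j≥1} c_j T^j y`,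
`2εθ·Re d + ‖d·y − w₁‖² = 2Re⟨x₀ − y, w₁⟩`: the constraint `‖x₀ − V_y c‖ = ‖x₀ − y‖` is active
(`IsMinimal.norm_sub_eq`) and `x₀ − V_y c = (x₀ − y) + (d·y − w₁)`. [cite: Enflo2023, v2 p.12, eq. (25); pp.2–3 (the constraint of (1) is active)] -/
theorem activity_identity (T : H →L[ℂ] H) (hT1 : ‖T‖ < 1) (x₀ y : H) (t : ℝ) (ht : ⟪x₀ - y, y⟫_ℂ = t)
    (hlt : ‖x₀ - y‖ < ‖x₀‖) {c : ℓ2} (hc : IsMinimal (V T hT1 y) x₀ ‖x₀ - y‖ c) :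
    2 * t * (1 - (c 0).re) + ‖(1 - c 0) • y - V T hT1 y (S (L c))‖ ^ 2
      = 2 * (⟪x₀ - y, V T hT1 y (S (L c))⟫_ℂ).re := by
  have hact : ‖x₀ - V T hT1 y c‖ = ‖x₀ - y‖ := hc.norm_sub_eq hlt
  have hVc : V T hT1 y c = c 0 • y + V T hT1 y (S (L c)) := by rw [V_shift]; exact V_decomp T hT1 y c
  have hsplit : x₀ - V T hT1 y c = (x₀ - y) + ((1 - c 0) • y - V T hT1 y (S (L c))) := by
    rw [hVc, sub_smul, one_smul]; abel
  have h : ‖x₀ - V T hT1 y c‖ ^ 2 = ‖x₀ - y‖ ^ 2 := by rw [hact]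
  rw [hsplit, norm_add_sq (𝕜 := ℂ) (x₀ - y), RCLike.re_to_complex, inner_sub_right, inner_smul_right, ht,
    Complex.sub_re] at h
  have hre : ((1 - c 0) * (t : ℂ)).re = t * (1 - (c 0).re) := by
    simp only [Complex.mul_re, Complex.sub_re, Complex.one_re, Complex.ofReal_re, Complex.sub_im,
      Complex.one_im, Complex.ofReal_im, mul_zero, sub_zero]
    ring
  rw [hre] at h
  linarith only [h]

/-- **(25), repaired (log-free form): the tail of THE minimiser is bounded below.**  `‖T‖ ≤ 10⁻²⁰`,
`⟨x₀ − y, y⟩ = εθ ∈ (0, 10⁻³]`, `‖y‖ ≤ 1`, `‖x₀ − y‖ ≤ 1`, `‖x₀ − y‖ < ‖x₀‖`, Case I at some `j ≥ 1`; `c` THE minimal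
solution of (1) for `V_y` at radius `‖x₀ − y‖`.  Then `(Σ_{j≥1}|c_j|²)^{1/2} = ‖Lc‖ ≥ 0.98·10²⁰·(εθ)^{11}`:
by `activity_identity` and `re_head_le_of_caseI`, `1.98(εθ)^{11} ≤ 2εθ·Re d ≤ 2|⟨x₀ − y, w₁⟩| ≤ 2‖w₁‖ ≤
2·1.0001·10⁻²⁰‖Lc‖`. [cite: Enflo2023, v2 p.12, Case I and eq. (25) (tex L386–L399)] -/
theorem tail_lower_bound_of_caseI (T : H →L[ℂ] H) (hT1 : ‖T‖ < 1) (hT : ‖T‖ ≤ 1 / 10 ^ 20) (x₀ y : H)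
    (t : ℝ) (ht : ⟪x₀ - y, y⟫_ℂ = t) (ht0 : 0 < t) (ht1 : t ≤ 1 / 10 ^ 3) (hy1 : ‖y‖ ≤ 1)
    (hxy : ‖x₀ - y‖ ≤ 1) (hlt : ‖x₀ - y‖ < ‖x₀‖) (hI : ∃ j, 1 ≤ j ∧ t ^ 4 ≤ ‖⟪x₀ - y, (T ^ j) y⟫_ℂ‖)
    {c : ℓ2} (hc : IsMinimal (V T hT1 y) x₀ ‖x₀ - y‖ c) :
    98 / 100 * 10 ^ 20 * t ^ 11 ≤ ‖L c‖ := by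
  have hid := activity_identity T hT1 x₀ y t ht hlt hc
  obtain ⟨-, hre⟩ := re_head_le_of_caseI T hT1 hT x₀ y t ht ht0 ht1 hy1 hI hc
  have hw₁ : ‖V T hT1 y (S (L c))‖ ≤ 1 / 10 ^ 20 * (1 + 1 / 10 ^ 4) * ‖L c‖ := by
    have h := norm_V_sub_head_le T hT1 y c
    rw [V_decomp T hT1 y c, add_sub_cancel_left, ← V_shift] at h
    calc ‖V T hT1 y (S (L c))‖ ≤ ‖T‖ * (‖y‖ * Real.sqrt (1 / (1 - ‖T‖ ^ 2))) * ‖L c‖ := h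
      _ ≤ 1 / 10 ^ 20 * (1 + 1 / 10 ^ 4) * ‖L c‖ := by
          gcongr
          exact norm_y_mul_sqrt_le hT hy1
  have hpair : (⟪x₀ - y, V T hT1 y (S (L c))⟫_ℂ).re ≤ 1 * (1 / 10 ^ 20 * (1 + 1 / 10 ^ 4) * ‖L c‖) := by
    refine le_trans (le_trans (le_abs_self _) (Complex.abs_re_le_norm _)) ?_
    refine le_trans (norm_inner_le_norm _ _) ?_
    exact mul_le_mul hxy hw₁ (norm_nonneg _) zero_le_one
  have hprog : 2 * t * (0.99 * t ^ 10) ≤ 2 * t * (1 - (c 0).re) :=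
    mul_le_mul_of_nonneg_left (by linarith only [hre]) (by linarith only [ht0])
  have ht11 : 0 ≤ t ^ 11 := pow_nonneg ht0.le 11
  linarith only [hid, hpair, hprog, sq_nonneg ‖(1 - c 0) • y - V T hT1 y (S (L c))‖, ht11]

/-- **(25), repaired, with (9) at `y`** (the referee's form, packet STEPS S13): if moreover `|⟨x₀ − y, T^j y⟩| ≤ εθ`
for all `j` (as for every point produced by a minimal move, `Vy.eq9_pow`), then
`(m + 2)·‖Lc‖ ≥ 0.99(εθ)^{10}`, `m = [1 + log_K(1/εθ)]`, i.e. `Σ_{j≥1}|c_j|² ≥ 0.98(εθ)^{20}/(m+2)²` — the pairing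
`⟨x₀ − y, w₁⟩` is now bounded by `Lemma2.norm_inner_V_le` (`≤ ‖Lc‖(m+2)εθ`) instead of the operator norm.  Sharper
than `tail_lower_bound_of_caseI` exactly when `εθ < 10⁻²⁰/(m+2)`. [cite: Enflo2023, v2 p.12, Case I and eq. (25); p.10, proof of Lemma 2 (the index `m`)] -/
theorem tail_lower_bound_of_caseI_h9 (T : H →L[ℂ] H) (hT1 : ‖T‖ < 1) (hT : ‖T‖ ≤ 1 / 10 ^ 20) (x₀ y : H)
    (t : ℝ) (ht : ⟪x₀ - y, y⟫_ℂ = t) (ht0 : 0 < t) (ht1 : t ≤ 1 / 10 ^ 3) (hy1 : ‖y‖ ≤ 1)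
    (hxy : ‖x₀ - y‖ ≤ 1) (hlt : ‖x₀ - y‖ < ‖x₀‖) (hI : ∃ j, 1 ≤ j ∧ t ^ 4 ≤ ‖⟪x₀ - y, (T ^ j) y⟫_ℂ‖)
    (h9 : ∀ j : ℕ, ‖⟪x₀ - y, (T ^ j) y⟫_ℂ‖ ≤ t)
    {c : ℓ2} (hc : IsMinimal (V T hT1 y) x₀ ‖x₀ - y‖ c) :
    99 / 100 * t ^ 10 ≤ (mIdx t + 2) * ‖L c‖ := by
  have hid := activity_identity T hT1 x₀ y t ht hlt hc
  obtain ⟨-, hre⟩ := re_head_le_of_caseI T hT1 hT x₀ y t ht ht0 ht1 hy1 hI hc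
  have hTK : ‖T‖ ≤ 1 / bigK := by unfold bigK; exact hT
  have hR : ∀ j, ‖(S (L c)) j‖ ≤ ‖L c‖ := by
    intro j
    cases j with
    | zero => rw [S_apply_zero, norm_zero]; exact norm_nonneg _
    | succ j => rw [S_apply_succ]; exact lp.norm_apply_le_norm (by norm_num) (L c) j
  have hpair : (⟪x₀ - y, V T hT1 y (S (L c))⟫_ℂ).re ≤ ‖L c‖ * ((mIdx t + 2) * t) :=
    le_trans (le_trans (le_abs_self _) (Complex.abs_re_le_norm _))
      (norm_inner_V_le T hT1 hTK hy1 hxy ht0 h9 (S (L c)) hR)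
  have hprog : 2 * t * (0.99 * t ^ 10) ≤ 2 * t * (1 - (c 0).re) :=
    mul_le_mul_of_nonneg_left (by linarith only [hre]) (by linarith only [ht0])
  have hkey : t * (99 / 100 * t ^ 10) ≤ t * ((mIdx t + 2) * ‖L c‖) := by
    linarith only [hid, hpair, hprog, sq_nonneg ‖(1 - c 0) • y - V T hT1 y (S (L c))‖]
  exact le_of_mul_le_mul_left hkey ht0

/-- **The printed (25) in its printed range.**  Under the hypotheses of `tail_lower_bound_of_caseI` and
`εθ ≥ 2·10⁻⁶`: `Σ_{j≥1}|c_j|² = ‖Lc‖² ≥ (εθ)^{15}` (since `0.96·10⁴⁰(εθ)^{22} ≥ (εθ)^{15}` iff `(εθ)⁷ ≥ 1.05·10⁻⁴⁰`).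
For `εθ < 1.9·10⁻⁶` the exponent `15` is NOT derivable this way (the derivable exponents are `22`, resp. `20` up to a
logarithm with (9)); the statement actually used downstream is `tail_lower_bound_of_caseI`. [cite: Enflo2023, v2 p.12, eq. (25)] -/
theorem eq25_printed_of_caseI (T : H →L[ℂ] H) (hT1 : ‖T‖ < 1) (hT : ‖T‖ ≤ 1 / 10 ^ 20) (x₀ y : H)
    (t : ℝ) (ht : ⟪x₀ - y, y⟫_ℂ = t) (ht0 : 2 / 10 ^ 6 ≤ t) (ht1 : t ≤ 1 / 10 ^ 3) (hy1 : ‖y‖ ≤ 1)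
    (hxy : ‖x₀ - y‖ ≤ 1) (hlt : ‖x₀ - y‖ < ‖x₀‖) (hI : ∃ j, 1 ≤ j ∧ t ^ 4 ≤ ‖⟪x₀ - y, (T ^ j) y⟫_ℂ‖)
    {c : ℓ2} (hc : IsMinimal (V T hT1 y) x₀ ‖x₀ - y‖ c) :
    t ^ 15 ≤ ‖L c‖ ^ 2 := by
  have ht0' : 0 < t := lt_of_lt_of_le (by norm_num) ht0
  have h := tail_lower_bound_of_caseI T hT1 hT x₀ y t ht ht0' ht1 hy1 hxy hlt hI hc
  have h2 : (98 / 100 * 10 ^ 20 * t ^ 11) ^ 2 ≤ ‖L c‖ ^ 2 := pow_le_pow_left₀ (by positivity) h 2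
  have h7 : (2 / 10 ^ 6 : ℝ) ^ 7 ≤ t ^ 7 := pow_le_pow_left₀ (by norm_num) ht0 7
  have h15 : 0 ≤ t ^ 15 := pow_nonneg ht0'.le 15
  have hexp : (98 / 100 * 10 ^ 20 * t ^ 11) ^ 2 = (98 / 100 * 10 ^ 20) ^ 2 * (t ^ 7 * t ^ 15) := by ring
  rw [hexp] at h2
  nlinarith [h2, h7, h15, mul_le_mul_of_nonneg_right h7 h15]

end CaseI

end Literature.Analysis.OperatorTheory.Enflo2023

end
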